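import Literature.Analysis.FunctionSpaces.SobolevDomainProofs
import Summits.QuantumFields.YangMills.Theorems.PoincareLipschitzSamplingCells
import Mathlib.Analysis.InnerProductSpace.PiL2
import Mathlib.MeasureTheory.Integral.Bochner.Set
import HarnessLib

/-!
# Crux `BlockLipschitzL` (stmt-QuantumFields-23533) ∕ `HistoryTailL` (stmt-QuantumFields-19936), LINE 25 «CompactnessTransfer»,
# stub S1″ — FILE 1 «THE BALL BRIDGE»: S1″'s cube-competitor minimality ⇒ energy minimality on balls [Simon1996 §2.1]

Cell `ym3-torus` (YM ladder rung R3 = continuum SU(2) Yang–Mills on T³ — a RUNG, NOT the Clay problem: not d = 4, not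
infinite volume, not a mass gap); WIDTH helper seat `ym-ust-19936-w3` g15.  Helper `--supports stmt-QuantumFields-19936`;
THEOREMS ONLY (0 `def`, 0 `sorry`, default heartbeats); imports: lit ✓`SobolevDomainProofs` (`HasWeakFDerivOn`, uniqueness
of weak derivatives `HasWeakFDerivOn.unique_holds`, restriction `HasWeakFDerivOn.mono_set_holds`), ✓`PoincareLipschitzSamplingCells`
(cube letters), Mathlib.

S1″ (`stub_uniformSmallScaleEnergy`, ideator v1.4, Sobolev vocabulary) asks minimality of `∫_Q Σᵢ‖G eᵢ‖²` against every
finite-energy unit `W^{1,2}` competitor `(V, GV)` on the open unit cube `Q ⊂ ℝ³` agreeing with `U` (pointwise) off a compact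
sub-cube `Q_s`, `s < 1`.  [Simon1996, §2.1] asks, for every ball `B̄_ρ(y) ⊂ Q`, minimality of `∫_{B_ρ(y)}` against competitors
agreeing with the minimiser near `∂B_ρ(y)`; phrased with globally defined finite-energy unit `W^{1,2}(Q)` competitors `(W, GW)`
that agree with `U` off a smaller concentric ball `B_{ρ′}(y)`, `ρ′ < ρ`, THE FORMER IMPLIES THE LATTER: such a `W` agrees
with `U` off `Q_s` for `s := ρ′ + maxᵢ|yᵢ| < 1`, and on the open set `Q ∖ B̄_{ρ′}(y) ⊇ Q ∖ B_ρ(y)` both `GW` and `G` are weak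
gradients of `U`, hence a.e. equal (uniqueness of weak derivatives), so the two total energies differ exactly by the two ball
energies.  This puts S1″'s hypothesis in the class to which the printed rows (monotonicity, compactness, regularity — FILE 2
`…PoincareLipschitzUniformSmallScaleEnergyOfRows`) apply.

WHAT IS PROVED (ns `…Theorems.PoincareLipschitzMinimiserBallBridge`).
* §1 cube ∕ ball letters: `absCube_subset_ball` (`Q_r ⊆ B(0, √3·r)`), `ball_subset_absCube` (`B(0,ρ) ⊆ Q_ρ`),
  `closedBall_subset_unitCube` (`B̄(0,ρ) ⊆ Q`, `ρ < 1`), `abs_add_lt_one_of_closedBall_subset` (`B̄_ρ(y) ⊆ Q ⇒ |yᵢ| + ρ < 1`),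
  `abs_lt_of_mem_ball`.
* §2 ★ `energy_ball_le_of_cubeMin` — THE BRIDGE.
HONEST SCOPE.  Letters; S1″, S2♭″, `hHalvingBand`, K1, `MeanDeviationL`, `BlockLipschitzL`, `HistoryTailL` are NOT proved here.
YM₃ on T³ is rung R3, not Clay; YM gap NOT proved; no summit statement is proved here.

References: L. Simon, Theorems on Regularity and Singularity of Energy Minimizing Maps, Birkhäuser 1996 [Simon1996] (§2.1);
L. C. Evans, Partial Differential Equations, 2nd ed. (2010) [Evans2010] (§5.2.1, uniqueness of weak derivatives).
-/

set_option autoImplicit false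

noncomputable section

open scoped BigOperators Topology
open MeasureTheory Set Filter Metric

namespace Summit.QuantumFields.YangMills.Theorems.PoincareLipschitzMinimiserBallBridge

open Literature.Analysis.FunctionSpaces (HasWeakFDerivOn)
open Summit.QuantumFields.YangMills.Theorems.PoincareLipschitzSamplingCells (isOpen_absCube
  isCompact_absCubeClosed volume_real_absCube)

/-! ## §1 Cube ∕ ball letters in `ℝ³` -/

/-- The open sup-norm cube `{|xᵢ| < r}` (`r > 0`) lies in the Euclidean ball `B(0, √3·r)`. [folklore] -/
theorem absCube_subset_ball {r : ℝ} (hr : 0 < r) :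
    {x : EuclideanSpace ℝ (Fin 3) | ∀ i : Fin 3, |x i| < r} ⊆ ball 0 (Real.sqrt 3 * r) := by
  intro x hx
  rw [mem_ball, dist_zero_right, EuclideanSpace.norm_eq]
  have hsum : ∑ i : Fin 3, ‖x i‖ ^ 2 < 3 * r ^ 2 := by
    calc ∑ i : Fin 3, ‖x i‖ ^ 2 < ∑ _i : Fin 3, r ^ 2 :=
          Finset.sum_lt_sum_of_nonempty Finset.univ_nonempty fun i _ => by
            rw [Real.norm_eq_abs]; exact pow_lt_pow_left₀ (hx i) (abs_nonneg _) two_ne_zero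
      _ = 3 * r ^ 2 := by simp
  calc √(∑ i : Fin 3, ‖x i‖ ^ 2) < √(3 * r ^ 2) :=
        Real.sqrt_lt_sqrt (Finset.sum_nonneg fun i _ => by positivity) hsum
    _ = √3 * r := by rw [Real.sqrt_mul (by norm_num), Real.sqrt_sq hr.le]

/-- The Euclidean ball `B(0, ρ)` lies in the open sup-norm cube `{|xᵢ| < ρ}`. [folklore] -/
theorem ball_subset_absCube (ρ : ℝ) :
    ball (0 : EuclideanSpace ℝ (Fin 3)) ρ ⊆ {x : EuclideanSpace ℝ (Fin 3) | ∀ i : Fin 3, |x i| < ρ} := by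
  intro x hx i
  rw [mem_ball, dist_zero_right] at hx
  calc |x i| = ‖x i‖ := (Real.norm_eq_abs _).symm
    _ ≤ ‖x‖ := PiLp.norm_apply_le x i
    _ < ρ := hx

/-- The closed Euclidean ball `B̄(0, ρ)`, `ρ < 1`, lies in the open unit cube `Q = {|xᵢ| < 1}`. [folklore] -/
theorem closedBall_subset_unitCube {ρ : ℝ} (hρ : ρ < 1) :
    closedBall (0 : EuclideanSpace ℝ (Fin 3)) ρ ⊆ {x : EuclideanSpace ℝ (Fin 3) | ∀ i : Fin 3, |x i| < 1} := by
  intro x hx i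
  rw [mem_closedBall, dist_zero_right] at hx
  calc |x i| = ‖x i‖ := (Real.norm_eq_abs _).symm
    _ ≤ ‖x‖ := PiLp.norm_apply_le x i
    _ ≤ ρ := hx
    _ < 1 := hρ

/-- If the closed ball `B̄(y, ρ)` lies in the open unit cube then `|yᵢ| + ρ < 1` for every coordinate
(test the points `y ± ρ eᵢ`). [folklore] -/
theorem abs_add_lt_one_of_closedBall_subset {y : EuclideanSpace ℝ (Fin 3)} {ρ : ℝ} (hρ : 0 ≤ ρ)
    (h : closedBall y ρ ⊆ {x : EuclideanSpace ℝ (Fin 3) | ∀ i : Fin 3, |x i| < 1}) (i : Fin 3) :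
    |y i| + ρ < 1 := by
  have key : ∀ t : ℝ, |t| = ρ → |y i + t| < 1 := by
    intro t ht
    have hmem : y + EuclideanSpace.single i t ∈ closedBall y ρ := by
      rw [mem_closedBall, dist_eq_norm, add_sub_cancel_left, PiLp.norm_single, Real.norm_eq_abs, ht]
    have := h hmem i
    simpa [PiLp.single_apply] using this
  have h1 := key ρ (abs_of_nonneg hρ)
  have h2 := key (-ρ) (by rw [abs_neg, abs_of_nonneg hρ])
  rcases le_or_gt 0 (y i) with hy | hy
  · rw [abs_of_nonneg hy]; have := (abs_lt.mp h1).2; linarith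
  · rw [abs_of_neg hy]; have := (abs_lt.mp h2).1; linarith

/-- Points of the open ball `B(y, ρ')` have every coordinate below `ρ' + maxᵢ |yᵢ|`. [folklore] -/
theorem abs_lt_of_mem_ball {y x : EuclideanSpace ℝ (Fin 3)} {ρ' : ℝ} (hx : x ∈ ball y ρ') (i : Fin 3) :
    |x i| < ρ' + Finset.univ.sup' Finset.univ_nonempty (fun j : Fin 3 => |y j|) := by
  rw [mem_ball, dist_eq_norm] at hx
  have h1 : |x i - y i| ≤ ‖x - y‖ := by
    have := PiLp.norm_apply_le (x - y) i
    simpa [Real.norm_eq_abs] using this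
  have h2 : |y i| ≤ Finset.univ.sup' Finset.univ_nonempty (fun j : Fin 3 => |y j|) :=
    Finset.le_sup' (fun j : Fin 3 => |y j|) (Finset.mem_univ i)
  have h3 : |x i| ≤ |x i - y i| + |y i| := by
    have := abs_add_le (x i - y i) (y i); simpa using this
  linarith

/-! ## §2 The bridge: S1″'s cube-competitor minimality ⇒ energy minimality on balls [Simon1996 §2.1]

S1″ (`S1pp`, ideator v1.4) asks minimality of `∫_Q Σ‖G eᵢ‖²` against every finite-energy unit `W^{1,2}` competitor
`(V, GV)` on `Q` agreeing with `U` (pointwise) off a compact sub-cube `Q_s`, `s < 1`.  [Simon1996, §2.1] asks, for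
every ball `B̄_ρ(y) ⊂ Q`, minimality of `∫_{B_ρ(y)}` against competitors agreeing with `u` near `∂B_ρ(y)`; phrased
with globally defined competitors `(W, GW)` on `Q` that agree with `U` off a smaller concentric ball `B_{ρ'}(y)`,
`ρ' < ρ`, the former implies the latter: such a `W` agrees with `U` off `Q_s` for `s := ρ' + maxᵢ|yᵢ| < 1`, and on
the open set `Q ∖ B̄_{ρ'}(y) ⊇ Q ∖ B_ρ(y)` both `GW` and `G` are weak gradients of `U`, hence a.e. equal
(uniqueness of weak derivatives, lit ✓`HasWeakFDerivOn.unique_holds`), so the two total energies differ exactly by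
the two ball energies. -/

/-- ★ THE BRIDGE.  Cube-competitor minimality on `Q` (S1″'s hypothesis, verbatim shape) implies minimality of the
Dirichlet energy on every ball `B̄_ρ(y) ⊂ Q` against finite-energy unit `W^{1,2}(Q)` competitors agreeing with `U`
off a smaller concentric ball [Simon1996, §2.1 (definition of energy minimizing map)]. [folklore] -/
theorem energy_ball_le_of_cubeMin
    (hQ : IsOpen {x : EuclideanSpace ℝ (Fin 3) | ∀ i : Fin 3, |x i| < 1})
    (U : EuclideanSpace ℝ (Fin 3) → EuclideanSpace ℝ (Fin 4))
    (G : EuclideanSpace ℝ (Fin 3) → (EuclideanSpace ℝ (Fin 3) →L[ℝ] EuclideanSpace ℝ (Fin 4)))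
    (hU : HasWeakFDerivOn ⟨{x : EuclideanSpace ℝ (Fin 3) | ∀ i : Fin 3, |x i| < 1}, hQ⟩ volume U G)
    (hGi : IntegrableOn (fun x => ∑ i : Fin 3, ‖G x (EuclideanSpace.single i (1:ℝ))‖ ^ 2)
      {x : EuclideanSpace ℝ (Fin 3) | ∀ i : Fin 3, |x i| < 1})
    (hmin : ∀ (V : EuclideanSpace ℝ (Fin 3) → EuclideanSpace ℝ (Fin 4))
        (GV : EuclideanSpace ℝ (Fin 3) → (EuclideanSpace ℝ (Fin 3) →L[ℝ] EuclideanSpace ℝ (Fin 4))) (s : ℝ), s < 1 →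
      HasWeakFDerivOn ⟨{x : EuclideanSpace ℝ (Fin 3) | ∀ i : Fin 3, |x i| < 1}, hQ⟩ volume V GV →
      (∀ x : EuclideanSpace ℝ (Fin 3), (∀ i : Fin 3, |x i| < 1) → ‖V x‖ = 1) →
      IntegrableOn (fun x => ∑ i : Fin 3, ‖GV x (EuclideanSpace.single i (1:ℝ))‖ ^ 2)
        {x : EuclideanSpace ℝ (Fin 3) | ∀ i : Fin 3, |x i| < 1} →
      (∀ x : EuclideanSpace ℝ (Fin 3), (∃ i : Fin 3, s ≤ |x i|) → V x = U x) →
      ∫ x in {x : EuclideanSpace ℝ (Fin 3) | ∀ i : Fin 3, |x i| < 1}, ∑ i : Fin 3, ‖G x (EuclideanSpace.single i (1:ℝ))‖ ^ 2 ≤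
        ∫ x in {x : EuclideanSpace ℝ (Fin 3) | ∀ i : Fin 3, |x i| < 1}, ∑ i : Fin 3, ‖GV x (EuclideanSpace.single i (1:ℝ))‖ ^ 2)
    (y : EuclideanSpace ℝ (Fin 3)) (ρ : ℝ) (hρ : 0 < ρ)
    (hyρ : closedBall y ρ ⊆ {x : EuclideanSpace ℝ (Fin 3) | ∀ i : Fin 3, |x i| < 1})
    (W : EuclideanSpace ℝ (Fin 3) → EuclideanSpace ℝ (Fin 4))
    (GW : EuclideanSpace ℝ (Fin 3) → (EuclideanSpace ℝ (Fin 3) →L[ℝ] EuclideanSpace ℝ (Fin 4)))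
    (hW : HasWeakFDerivOn ⟨{x : EuclideanSpace ℝ (Fin 3) | ∀ i : Fin 3, |x i| < 1}, hQ⟩ volume W GW)
    (hW1 : ∀ x : EuclideanSpace ℝ (Fin 3), (∀ i : Fin 3, |x i| < 1) → ‖W x‖ = 1)
    (hGWi : IntegrableOn (fun x => ∑ i : Fin 3, ‖GW x (EuclideanSpace.single i (1:ℝ))‖ ^ 2)
      {x : EuclideanSpace ℝ (Fin 3) | ∀ i : Fin 3, |x i| < 1})
    (hWU : ∃ ρ' : ℝ, ρ' < ρ ∧ ∀ x : EuclideanSpace ℝ (Fin 3), x ∉ ball y ρ' → W x = U x) :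
    ∫ x in ball y ρ, ∑ i : Fin 3, ‖G x (EuclideanSpace.single i (1:ℝ))‖ ^ 2 ≤
      ∫ x in ball y ρ, ∑ i : Fin 3, ‖GW x (EuclideanSpace.single i (1:ℝ))‖ ^ 2 := by
  obtain ⟨ρ', hρ', hWU⟩ := hWU
  -- the cube parameter `s := ρ' + maxᵢ |yᵢ| < 1`
  obtain ⟨j, -, hj⟩ := Finset.exists_mem_eq_sup' (Finset.univ_nonempty (α := Fin 3)) (fun j : Fin 3 => |y j|)
  have hs1 : ρ' + Finset.univ.sup' Finset.univ_nonempty (fun j : Fin 3 => |y j|) < 1 := by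
    rw [hj]; have := abs_add_lt_one_of_closedBall_subset hρ.le hyρ j; linarith
  have hWUs : ∀ x : EuclideanSpace ℝ (Fin 3),
      (∃ i : Fin 3, ρ' + Finset.univ.sup' Finset.univ_nonempty (fun j : Fin 3 => |y j|) ≤ |x i|) → W x = U x := by
    rintro x ⟨i, hi⟩
    refine hWU x fun hxb => ?_
    have := abs_lt_of_mem_ball hxb i
    linarith
  have hQle := hmin W GW _ hs1 hW hW1 hGWi hWUs
  -- a.e. equality of the two weak gradients on the open set `O := Q ∖ B̄_{ρ'}(y)`
  have hOo : IsOpen ({x : EuclideanSpace ℝ (Fin 3) | ∀ i : Fin 3, |x i| < 1} ∩ (closedBall y ρ')ᶜ) :=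
    hQ.inter isClosed_closedBall.isOpen_compl
  have hOle : (⟨{x : EuclideanSpace ℝ (Fin 3) | ∀ i : Fin 3, |x i| < 1} ∩ (closedBall y ρ')ᶜ, hOo⟩ :
      TopologicalSpace.Opens (EuclideanSpace ℝ (Fin 3))) ≤ ⟨{x : EuclideanSpace ℝ (Fin 3) | ∀ i : Fin 3, |x i| < 1}, hQ⟩ :=
    fun x hx => hx.1
  have hUO := Literature.Analysis.FunctionSpaces.HasWeakFDerivOn.mono_set_holds hU hOle
  have hWO := Literature.Analysis.FunctionSpaces.HasWeakFDerivOn.mono_set_holds hW hOle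
  have hOmeas : MeasurableSet ({x : EuclideanSpace ℝ (Fin 3) | ∀ i : Fin 3, |x i| < 1} ∩ (closedBall y ρ')ᶜ) :=
    hOo.measurableSet
  have hWUO : ∀ x ∈ {x : EuclideanSpace ℝ (Fin 3) | ∀ i : Fin 3, |x i| < 1} ∩ (closedBall y ρ')ᶜ, W x = U x :=
    fun x hx => hWU x fun hb => hx.2 (ball_subset_closedBall hb)
  have hUO' : HasWeakFDerivOn ⟨{x : EuclideanSpace ℝ (Fin 3) | ∀ i : Fin 3, |x i| < 1} ∩ (closedBall y ρ')ᶜ, hOo⟩ volume U GW := by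
    refine ⟨hUO.locallyIntegrableOn, hWO.locallyIntegrableOn_deriv, fun φ v hφ => ?_⟩
    rw [← hWO.integral_fderiv_smul_eq φ v hφ]
    refine setIntegral_congr_fun hOmeas fun x hx => ?_
    simp only [hWUO x hx]
  have hae := Literature.Analysis.FunctionSpaces.HasWeakFDerivOn.unique_holds hUO' hUO
  -- the complements of the ball inside `Q` carry equal energies
  have hsub : {x : EuclideanSpace ℝ (Fin 3) | ∀ i : Fin 3, |x i| < 1} \ ball y ρ ⊆
      {x : EuclideanSpace ℝ (Fin 3) | ∀ i : Fin 3, |x i| < 1} ∩ (closedBall y ρ')ᶜ := by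
    rintro x ⟨hxQ, hxb⟩
    refine ⟨hxQ, fun hxc => hxb ?_⟩
    rw [mem_closedBall] at hxc; rw [mem_ball]; linarith
  have hcompl : ∫ x in {x : EuclideanSpace ℝ (Fin 3) | ∀ i : Fin 3, |x i| < 1} \ ball y ρ,
        ∑ i : Fin 3, ‖GW x (EuclideanSpace.single i (1:ℝ))‖ ^ 2 =
      ∫ x in {x : EuclideanSpace ℝ (Fin 3) | ∀ i : Fin 3, |x i| < 1} \ ball y ρ,
        ∑ i : Fin 3, ‖G x (EuclideanSpace.single i (1:ℝ))‖ ^ 2 := by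
    refine integral_congr_ae ?_
    have hae' := ae_restrict_of_ae_restrict_of_subset hsub hae
    filter_upwards [hae'] with x hx
    simp only [hx]
  -- split both total energies along the ball
  have hbQ : {x : EuclideanSpace ℝ (Fin 3) | ∀ i : Fin 3, |x i| < 1} ∩ ball y ρ = ball y ρ :=
    inter_eq_right.mpr (ball_subset_closedBall.trans hyρ)
  have hsplitG := integral_inter_add_sdiff (μ := volume) (t := ball y ρ) measurableSet_ball hGi
  have hsplitW := integral_inter_add_sdiff (μ := volume) (t := ball y ρ) measurableSet_ball hGWi
  rw [hbQ] at hsplitG hsplitW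
  linarith

end Summit.QuantumFields.YangMills.Theorems.PoincareLipschitzMinimiserBallBridge

end
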